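import Literature.NumberTheory.ComplexMultiplication.MainTheoremCMLevelUniformization
import Literature.NumberTheory.ComplexMultiplication.MainTheoremCMLevelGluing
import HarnessLib

/-!
# The main theorem of complex multiplication — the level-gluing stub `levelGluing` holds (Shimura 1998, §18.6)

Topic `Literature/NumberTheory/ComplexMultiplication`, namespace `Literature.NumberTheory.ComplexMultiplication`.
Theorems only (no definition, no named fact; net Literature debt **−1**: discharges the ruled target
`levelGluing` of `MainTheoremCMLevelUniformization.lean`, row II-1-S7-junction, stub S7b of the line
`b2-main-theorem-cm`, cell `hodgecm-mathlib`, D-0151).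

`levelGluing_holds`: the `Prop` `levelGluing` (two `IsLevelUniformization` data at levels `N ∣ N′`, `3 ≤ N`,
with the same invariant `ν`, plus the Rosati/radical clauses of the divisor, give `ξ″ = ξ′`) is the landed gluing
theorem `CMTypeUniformization.r_eq_of_levelData` (MainTheoremCMLevelGluing.lean) read at `A := A₀ ⊗ ℂ`,
`X := πA^* X`, `σ := σ.toRingEquiv`, `t := g(s)_𝐡⁻¹` — [Shimura1998] §18.6, last paragraph of the proof of
Thm. 18.6 (p. 129): «Then `ξ″ = ι^σ(b) ∘ ξ′` with `b ∈ 𝔬^×` … `b b^ρ = 1` … `b` must be a root of unity …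
`b − 1 ∈ M𝔬`, and hence `b = 1` … Thus `ξ′ = ξ″`.»

## References

* [Shimura1998] G. Shimura, *Abelian Varieties with Complex Multiplication and Modular Functions*, Princeton
  Univ. Press 1998, §18.6, proof of Thm. 18.6, p. 129.
-/

noncomputable section

open CategoryTheory CategoryTheory.Limits AlgebraicGeometry NumberField IsDedekindDomain
open scoped NumberField nonZeroDivisors
open Literature.AlgebraicGeometry.Motives Literature.AlgebraicGeometry.Motives.AbelianVariety

namespace Literature.NumberTheory.ComplexMultiplication

/-- **Stub S7b `levelGluing` of the line `b2-main-theorem-cm` HOLDS**: unpack the two `IsLevelUniformization`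
hypotheses (clause (2) at the two levels, the level arithmetic `q·ββ^ρ = ν`, `𝔞 ⊆ β𝔟`, the congruence
elements, and the relative polarisation clauses) and apply `CMTypeUniformization.r_eq_of_levelData`.
[cite: Shimura1998, §18.6 proof of Thm. 18.6, p. 129 («Thus ξ′ = ξ″»)] -/
theorem levelGluing_holds : levelGluing := by
  intro K _ _ _ Φ _ 𝔞 𝔟 L _ _ _ A₀ ι₀ X πA _hπA _ ξ σ s h𝔟 πσ hπσ _ ℓ _ _ _ hros c hrad ν N N' hN hNN' _ ξ' ξ'' q q'
    β β' hL hL'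
  obtain ⟨h2, _, _, hν, _, ht, hpair⟩ := hL
  obtain ⟨h2', hβ', _, hν', h𝔞𝔟', ht', hpair'⟩ := hL'
  exact CMTypeUniformization.r_eq_of_levelData Φ 𝔞 𝔟 (X.pullback πA) ξ σ.toRingEquiv πσ hπσ ℓ hros c hrad
    (reflexNormFinitePart K Φ (traceField Φ) s)⁻¹ (by rw [h𝔟]; rfl) N N' hN hNN' ξ' ξ'' h2 h2' q q' β β' ν hβ'
    hν hν' h𝔞𝔟' ht ht' hpair hpair'

end Literature.NumberTheory.ComplexMultiplication

end
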